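import Summits.QuantumFields.YangMills.Theorems.FluctuationComparisonRegPrIntLS2BetaPosCollarAtIrreducible
import Summits.QuantumFields.YangMills.Theorems.FluctuationComparisonRegPrIntLS2BetaDescentLipschitz
import Summits.QuantumFields.YangMills.Theorems.FluctuationComparisonRegPrIntLS2BetaIrrOfCentralStab
import Summits.QuantumFields.YangMills.Theorems.FluctuationComparisonRegPrIntLS2BetaPosCollarLocalRows
import Summits.QuantumFields.YangMills.Theorems.FluctuationComparisonRegPrIntLS2BetaIsolOfCriticalOrbitUnique
import Summits.QuantumFields.YangMills.Theorems.FluctuationComparisonRegPrIntLS2BetaTubeRegularSmall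
import HarnessLib

/-!
# S2β · POS∘ ∕ TUBE♭ — (T7c) THE DOCK's END-TO-END AT AN IRREDUCIBLE DATUM: (Lπ)_loc, `hcont` AND ISOL∘(δ) DISCHARGED —
# POS∘ at print's regular minimiser ⟸ {IRR(V)} ALONE; TUBE♭ ⟸ {pen 4's central-stabiliser token, `hreg`(δ)} — per datum, `L ≥ 5`, `ε₀ ≤ e₉(L)`

Cell `ym3-torus` (YM ladder rung R3 = continuum `SU(2)` Yang–Mills on the three-torus at fixed lattice data — a RUNG: NOT d = 4, NOT infinite volume,
NOT a mass gap, NOT Clay).  Width seat `ym3-torus-px21` (gen 19), the (T)-chain of LINE g18-1 S2β ((T7a) `…S2BetaNearSymmetryRigidity`, (T7b) `…S2BetaPosCollarAtIrreducible`,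
(T7d) `…S2BetaIrrOfCentralStab`).  Crux `stmt-QuantumFields-20520` (`…Theses.UnitScaleTilt.FluctuationComparisonRegPrIntL`); `--kind proof --supports stmt-QuantumFields-20520
--as helper`, count-neutral, DEFINITION-FREE (0 `def`, 0 `instance`, 0 `notation`, 0 `sorry`, default heartbeats).

WHY.  (T7b) `growthOn_nhds_at_isCritR2_of_irr_five` displays, besides IRR(V), the per-datum letters `hcont` ((T2d)) and (Lπ)_loc; its TUBE♭ edition displays ISOL∘(δ).  All three are
now TREE THEOREMS at a regular base point: `hcont` = ✓(T2d) `…S2BetaPosCollarLocalRows.eventually_continuousAt_descendTo_of_mem_regFibrePr (hr3) (hr2)`; (Lπ)_loc = ✓px13 g20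
`…S2BetaDescentLipschitz.exists_threshold_supLipschitz` (sup-norm Lipschitz of the k-fold (0.4) average at a plaquette-regular background, no gauge fixing; its `exists_ePi` carries the
admissibility rows and the room row `(5L)²∕4·2e < 1∕24`); ISOL∘(δ) at a datum with CENTRAL STABILISER = ✓px8 `…S2BetaIsolOfCriticalOrbitUnique.isol_of_atMostOneCriticalOrbit` ∘
✓px17 pen 4 `…S2BetaCriticalOrbitUnique.atMostOneCriticalOrbit_of_centralStab_five` modulo the tube-regularity row `hreg`.  THIS FILE docks them, with ONE threshold
`e₉(L) := min (pen 3's e₈) (e_π∕2)` (and pen 4's for §3):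
* §1 ★★★ `growthOn_nhds_at_isCritR2_of_irr_five' (L) (h5 : 5 ≤ L) : ∃ e₉ > 0, ∀ F (F.L = L) J<K (γ b₀ p₀ ε₀) V U₀, 0<ε₀ → ε₀≤e₉ → U₀ ∈ regFibrePr ε₀ V → IsCritR2 V U₀ →
  A U₀ = minActionRegPr ε₀ V → IRR(V) → ∃ N ∈ 𝓝 U₀, ∃ c>0, ⟨intrinsic growth on N⟩` — PER-DATUM LETTERS LEFT: IRR(V) ONLY; ★★★ `posCollar_at_isCritR2_of_irr_five'` (⟹ px8's POS∘
  text VERBATIM, every δ), ★★★ `tubeGrowth_at_isCritR2_of_irr_of_isolated_five'` (+ ISOL∘(δ) VERBATIM ⟹ TUBE♭ VERBATIM).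
* §2 the same three keyed on ✓pen 4's GROUP token (`∀ s, s • V = V → s = 1 ∨ s = −1`) through ✓(T7d) `irr_of_centralStab`: `…_of_centralStab_five`.
* §3 ★★★★ `tubeGrowth_at_isCritR2_of_centralStab_of_hreg_five` — ISOL∘(δ) DISCHARGED TOO: TUBE♭(V,U₀) ⟸ {pen 4's token, `hreg`(δ) (✓px8's binder VERBATIM; px16 g18
  `…S2BetaTubeRegularSmall.exists_delta_hreg` supplies it for `δ ≤ δ₀(U₀)`)} at `ε₀ ≤ min e₉ (pen 4's e₈)`.
* §4 ★★★★ `tubeGrowth_smallTube_at_isCritR2_of_centralStab_of_CL_five` — `hreg` DISCHARGED for small tubes by ✓px16 g18 `…S2BetaTubeRegularSmall.exists_delta_isol_of_atMostOneCriticalOrbit`: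
  `∃ δ₀ > 0, ∀ δ ≤ δ₀`, TUBE♭(V,U₀;δ) ⟸ {{pen 4's token, CL(V) (`closure (fibre ∩ histGood) ⊆ fibre`)}} at `ε₀ ≤ e₉`.
CONSTANTS PER DATUM (existential `N c r μ δ₀`); thresholds `L`-only.  RESIDUE at a central-stabiliser datum: for POS∘ NOTHING; for TUBE♭ at a general `δ` the row `hreg`(δ), for
small `δ` only CL(V); the organ's datum-free `δ` and K-uniform `μ` (TUBE-REG∘) are NOT addressed.

HONEST: composition over landed theorems; nothing of Bałaban's analysis beyond the cited tree theorems; the REDUCIBLE stratum, `hreg` (for general δ), TUBE-REG∘ (datum-free δ, K-uniform μ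
in the organ's quantifier order), GAP♯∘, GAP♭, EXW∘, S2β, crux 20520 NOT proved; at `L = 3` pen 3's ∕ pen 4's Thm-2 socket is open (EMBARGO-LITE №58); no summit statement is proved by a
helper; finite-volume ∕ conditional; rung R3 = SU(2) YM₃ on T³ — NOT d = 4, NOT infinite volume, NOT a mass gap, NOT Clay; the Yang–Mills mass gap is NOT proved.  Sorry-free, axioms standard.

References: T. Bałaban, CMP **102** (1985) 277–309 [Balaban1985Variational] ((2)–(6) p.278, Thm 1 (8)–(10) p.279, Prop. 7 and (141)–(143) p.299); CMP **102** (1985) 255–275 [Balaban1985UV3]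
((12)–(13) p.259, (18)–(22) p.260); CMP **98** (1985) 17–51 [Balaban1985Averaging] ((8), (11)–(13) p.19, Prop. 2 (52)–(54) p.26, Prop. 5 (156)–(157) p.42); CMP **109** (1987) 249–301
[Balaban1987RG1] ((0.4), (0.11) p.253).
-/

set_option autoImplicit false

noncomputable section

namespace Summit.QuantumFields.YangMills.Theorems.FluctuationComparisonRegPrIntLS2BetaTubeGrowthAtIrreducible

open Set Filter Topology Function
open scoped Matrix.Norms.L2Operator
open Literature.MathematicalPhysics.QuantumFieldTheory.Balaban1983to89
open Literature.MathematicalPhysics.QuantumFieldTheory.Balaban1983to89.T3ContinuumYM3Torus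
open Literature.MathematicalPhysics.QuantumFieldTheory.Balaban1983to89.T3UnitLawDensityEML (ℰp)
open Literature.MathematicalPhysics.QuantumFieldTheory.Balaban1983to89.T3UnitScaleTilt
open Literature.MathematicalPhysics.QuantumFieldTheory.Balaban1983to89.T3TiltDescent
open Literature.MathematicalPhysics.QuantumFieldTheory.Balaban1983to89.T3ConstrainedMinimiser (fibre)
open Literature.MathematicalPhysics.QuantumFieldTheory.Balaban1983to89.T3PrintedRegularMinimiser
open Literature.MathematicalPhysics.QuantumFieldTheory.Balaban1983to89.ExpMeanLog (deltaSU)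
open Literature.MathematicalPhysics.QuantumFieldTheory.Balaban1983to89.T3Thm1CarrierNative (IsCritR2)
open Literature.MathematicalPhysics.QuantumFieldTheory.Balaban1983to89.T4Continuum
open scoped Literature.MathematicalPhysics.QuantumFieldTheory.Balaban1983to89.T3OrbitAverage
open Summit.QuantumFields.YangMills.Theorems.BlockAvgCorrector (stokesConst stokesConst_T3)
open Summit.QuantumFields.YangMills.Theorems.BrascampLiebVacuumSC.DimensionGapSU2 (neg_one_mem)
open Summit.QuantumFields.YangMills.Theorems.FluctuationComparisonRegPrIntLS2BetaPosCollarLocalRows (eventually_continuousAt_descendTo_of_mem_regFibrePr)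
open Summit.QuantumFields.YangMills.Theorems.FluctuationComparisonRegPrIntLS2BetaDescentLipschitz (exists_ePi exists_threshold_supLipschitz)
open Summit.QuantumFields.YangMills.Theorems.FluctuationComparisonRegPrIntLS2BetaPosCollarAtIrreducible
open Summit.QuantumFields.YangMills.Theorems.FluctuationComparisonRegPrIntLS2BetaIrrOfCentralStab (irr_of_centralStab)
open Summit.QuantumFields.YangMills.Theorems.FluctuationComparisonRegPrIntLS2BetaCriticalOrbitUnique (atMostOneCriticalOrbit_of_centralStab_five)
open Summit.QuantumFields.YangMills.Theorems.FluctuationComparisonRegPrIntLS2BetaIsolOfCriticalOrbitUnique (isol_of_atMostOneCriticalOrbit)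

/-! ## §1 POS∘ ∕ TUBE♭ at print's regular minimiser over an irreducible datum: (Lπ)_loc and `hcont` discharged, one `L`-only threshold -/

section Irr

/-- ★★★ **INTRINSIC LOCAL GROWTH AT PRINT'S REGULAR MINIMISER OVER AN IRREDUCIBLE DATUM — (Lπ)_loc AND `hcont` DISCHARGED.**  For every `L ≥ 5` there is `e₉ > 0`
(`min` of pen 3's `e₈` and px13's `e_π∕2`) such that at every member `(F, J < K)`, every `0 < ε₀ ≤ e₉`, every datum `V` with scalar commutant (IRR(V)) and every R2-critical
`U₀ ∈ regFibrePr ε₀ V` realising `minActionRegPr ε₀ V`: intrinsic residual-orbit growth holds on a neighbourhood of `U₀` ((T4) §1's socket).  Per-datum letters left: IRR(V) only.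
[cite: Balaban1985Variational, (2)-(6) p.278, Thm 1 (8)-(10) p.279, (141)-(143) p.299; Balaban1985Averaging, Prop. 2 (52)-(54) p.26, Prop. 5 (157) p.42; Balaban1985RegularSpaces, Thm 2 p.83] -/
theorem growthOn_nhds_at_isCritR2_of_irr_five' (L : ℕ) (h5 : 5 ≤ L) :
    ∃ e₉ : ℝ, 0 < e₉ ∧
      ∀ (F : T3Family), F.L = L → ∀ (J K : ℕ) (hJK : J < K) (γ b₀ p₀ ε₀ : ℝ)
        (V : GaugeField (F.P J) 0 (Matrix.specialUnitaryGroup (Fin 2) ℂ)) (U₀ : GaugeField (F.P K) 0 (Matrix.specialUnitaryGroup (Fin 2) ℂ)),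
        0 < ε₀ → ε₀ ≤ e₉ → U₀ ∈ regFibrePr F J K hJK.le ε₀ V → IsCritR2 F J K hJK.le V U₀ →
        wilsonAction4 U₀ = minActionRegPr F J K hJK.le ε₀ V →
        (∀ s : Site (F.P J) 0 → Matrix (Fin 2) (Fin 2) ℂ,
          (∀ b : PBond (F.P J) 0, s b.src * (V b : Matrix (Fin 2) (Fin 2) ℂ) = (V b : Matrix (Fin 2) (Fin 2) ℂ) * s b.tgt) →
            ∃ c : ℂ, ∀ x, s x = c • (1 : Matrix (Fin 2) (Fin 2) ℂ)) →
        ∃ N ∈ 𝓝 U₀, ∃ c : ℝ, 0 < c ∧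
          ∀ U ∈ closure (fibre F ℰp J K hJK.le V ∩ histGood F ℰp (θBal F.L γ b₀ p₀) K J), U ∈ N →
            c * (⨅ w : {w : Site (F.P K) 0 → Matrix.specialUnitaryGroup (Fin 2) ℂ |
                  ∀ U : GaugeField (F.P K) 0 (Matrix.specialUnitaryGroup (Fin 2) ℂ),
                    descendTo F ℰp J K hJK.le (GaugeField.gaugeAct w U) = descendTo F ℰp J K hJK.le U},
                ∑ ℓ : PBond (F.P K) 0,
                  dist1 (U ℓ * ((GaugeField.gaugeAct (w : Site (F.P K) 0 → Matrix.specialUnitaryGroup (Fin 2) ℂ) U₀) ℓ)⁻¹) ^ 2)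
              ≤ wilsonAction4 U - minActionRegPr F J K hJK.le ε₀ V := by
  obtain ⟨e₈, he₈, H⟩ := growthOn_nhds_at_isCritR2_of_irr_five L h5
  obtain ⟨eπ, heπ, Hπ⟩ := exists_threshold_supLipschitz L (by omega)
  obtain ⟨eπ', heπ', Hπ'⟩ := exists_ePi L (by omega)
  refine ⟨min e₈ (min eπ (eπ' / 2)), lt_min he₈ (lt_min heπ (by positivity)), ?_⟩
  intro F hF J K hJK γ b₀ p₀ ε₀ V U₀ hε₀ hεe hU₀reg hcrit hmin hirr
  have hε8 : ε₀ ≤ e₈ := hεe.trans (min_le_left _ _)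
  have hεπ : ε₀ ≤ eπ := hεe.trans ((min_le_right _ _).trans (min_le_left _ _))
  have hεπ' : 2 * ε₀ ≤ eπ' := by have := hεe.trans ((min_le_right _ _).trans (min_le_right _ _)); linarith
  obtain ⟨hr3, hr2, -⟩ := Hπ' (2 * ε₀) (by positivity) hεπ'
  rw [← hF] at hr2
  obtain ⟨ρ₀, Kπ, hρ₀, hKπ, hLip⟩ := Hπ F hF J K hJK.le ε₀ hε₀ hεπ V U₀ hU₀reg
  exact H F hF J K hJK ε₀ γ b₀ p₀ ε₀ V U₀ hε₀ hε8 hU₀reg hcrit hmin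
    (eventually_continuousAt_descendTo_of_mem_regFibrePr F hJK.le hε₀ hr3 hr2 hU₀reg) hirr ρ₀ Kπ hρ₀ hKπ hLip

/-- ★★★ **POS∘ AT PRINT'S REGULAR MINIMISER OVER AN IRREDUCIBLE DATUM ⟸ IRR(V) ALONE** (`ε₀ ≤ e₉(L)`; px8's `hpos` text VERBATIM, every `δ`).
[cite: Balaban1985Variational, Thm 1 (8)-(10) p.279, (141)-(143) p.299; Balaban1985UV3, (12)-(13) p.259] -/
theorem posCollar_at_isCritR2_of_irr_five' (L : ℕ) (h5 : 5 ≤ L) :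
    ∃ e₉ : ℝ, 0 < e₉ ∧
      ∀ (F : T3Family), F.L = L → ∀ (J K : ℕ) (hJK : J < K) (γ b₀ p₀ ε₀ : ℝ)
        (V : GaugeField (F.P J) 0 (Matrix.specialUnitaryGroup (Fin 2) ℂ)) (U₀ : GaugeField (F.P K) 0 (Matrix.specialUnitaryGroup (Fin 2) ℂ)) (δ : ℝ),
        0 < ε₀ → ε₀ ≤ e₉ → U₀ ∈ regFibrePr F J K hJK.le ε₀ V → IsCritR2 F J K hJK.le V U₀ →
        wilsonAction4 U₀ = minActionRegPr F J K hJK.le ε₀ V →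
        (∀ s : Site (F.P J) 0 → Matrix (Fin 2) (Fin 2) ℂ,
          (∀ b : PBond (F.P J) 0, s b.src * (V b : Matrix (Fin 2) (Fin 2) ℂ) = (V b : Matrix (Fin 2) (Fin 2) ℂ) * s b.tgt) →
            ∃ c : ℂ, ∀ x, s x = c • (1 : Matrix (Fin 2) (Fin 2) ℂ)) →
        ∃ r c : ℝ, 0 < r ∧ 0 < c ∧
          ∀ U ∈ closure (fibre F ℰp J K hJK.le V ∩ histGood F ℰp (θBal F.L γ b₀ p₀) K J),
            (∃ w : Site (F.P K) 0 → Matrix.specialUnitaryGroup (Fin 2) ℂ,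
              (∀ U'' : GaugeField (F.P K) 0 (Matrix.specialUnitaryGroup (Fin 2) ℂ),
                  descendTo F ℰp J K hJK.le (GaugeField.gaugeAct w U'') = descendTo F ℰp J K hJK.le U'') ∧
                ∀ ℓ : PBond (F.P K) 0, dist1 (U ℓ * ((GaugeField.gaugeAct w U₀) ℓ)⁻¹) ≤ δ) →
            (⨅ w : {w : Site (F.P K) 0 → Matrix.specialUnitaryGroup (Fin 2) ℂ |
                  ∀ U : GaugeField (F.P K) 0 (Matrix.specialUnitaryGroup (Fin 2) ℂ),
                    descendTo F ℰp J K hJK.le (GaugeField.gaugeAct w U) = descendTo F ℰp J K hJK.le U},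
                ∑ ℓ : PBond (F.P K) 0,
                  dist1 (U ℓ * ((GaugeField.gaugeAct (w : Site (F.P K) 0 → Matrix.specialUnitaryGroup (Fin 2) ℂ) U₀) ℓ)⁻¹) ^ 2) ≤ r →
            c * (⨅ w : {w : Site (F.P K) 0 → Matrix.specialUnitaryGroup (Fin 2) ℂ |
                  ∀ U : GaugeField (F.P K) 0 (Matrix.specialUnitaryGroup (Fin 2) ℂ),
                    descendTo F ℰp J K hJK.le (GaugeField.gaugeAct w U) = descendTo F ℰp J K hJK.le U},
                ∑ ℓ : PBond (F.P K) 0,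
                  dist1 (U ℓ * ((GaugeField.gaugeAct (w : Site (F.P K) 0 → Matrix.specialUnitaryGroup (Fin 2) ℂ) U₀) ℓ)⁻¹) ^ 2)
              ≤ wilsonAction4 U - minActionRegPr F J K hJK.le ε₀ V := by
  obtain ⟨e₉, he₉, H⟩ := growthOn_nhds_at_isCritR2_of_irr_five' L h5
  refine ⟨e₉, he₉, ?_⟩
  intro F hF J K hJK γ b₀ p₀ ε₀ V U₀ δ hε₀ hεe hU₀reg hcrit hmin hirr
  obtain ⟨N, hN, c, hc, hgrowN⟩ := H F hF J K hJK γ b₀ p₀ ε₀ V U₀ hε₀ hεe hU₀reg hcrit hmin hirr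
  exact FluctuationComparisonRegPrIntLS2BetaPosCollarOfLocalGrowth.posCollar_of_growthOn_nhds F hJK.le V U₀ δ hN hc hgrowN

/-- ★★★ **TUBE♭(V,U₀) AT PRINT'S REGULAR MINIMISER OVER AN IRREDUCIBLE DATUM ⟸ {IRR(V), ISOL∘(δ)}** (ISOL∘ = the `hisol` text VERBATIM; TUBE♭ VERBATIM).
[cite: Balaban1985Variational, Thm 1 (8)-(10) p.279, (141)-(143) p.299; Balaban1985UV3, (12)-(13) p.259 and (18)-(22) p.260] -/
theorem tubeGrowth_at_isCritR2_of_irr_of_isolated_five' (L : ℕ) (h5 : 5 ≤ L) :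
    ∃ e₉ : ℝ, 0 < e₉ ∧
      ∀ (F : T3Family), F.L = L → ∀ (J K : ℕ) (hJK : J < K) (γ b₀ p₀ ε₀ : ℝ)
        (V : GaugeField (F.P J) 0 (Matrix.specialUnitaryGroup (Fin 2) ℂ)) (U₀ : GaugeField (F.P K) 0 (Matrix.specialUnitaryGroup (Fin 2) ℂ)) (δ : ℝ),
        0 < ε₀ → ε₀ ≤ e₉ → U₀ ∈ regFibrePr F J K hJK.le ε₀ V → IsCritR2 F J K hJK.le V U₀ →
        wilsonAction4 U₀ = minActionRegPr F J K hJK.le ε₀ V →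
        (∀ s : Site (F.P J) 0 → Matrix (Fin 2) (Fin 2) ℂ,
          (∀ b : PBond (F.P J) 0, s b.src * (V b : Matrix (Fin 2) (Fin 2) ℂ) = (V b : Matrix (Fin 2) (Fin 2) ℂ) * s b.tgt) →
            ∃ c : ℂ, ∀ x, s x = c • (1 : Matrix (Fin 2) (Fin 2) ℂ)) →
        (∀ U ∈ closure (fibre F ℰp J K hJK.le V ∩ histGood F ℰp (θBal F.L γ b₀ p₀) K J),
            (∃ w : Site (F.P K) 0 → Matrix.specialUnitaryGroup (Fin 2) ℂ,
              (∀ U'' : GaugeField (F.P K) 0 (Matrix.specialUnitaryGroup (Fin 2) ℂ),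
                  descendTo F ℰp J K hJK.le (GaugeField.gaugeAct w U'') = descendTo F ℰp J K hJK.le U'') ∧
                ∀ ℓ : PBond (F.P K) 0, dist1 (U ℓ * ((GaugeField.gaugeAct w U₀) ℓ)⁻¹) ≤ δ) →
            wilsonAction4 U ≤ minActionRegPr F J K hJK.le ε₀ V →
            (⨅ w : {w : Site (F.P K) 0 → Matrix.specialUnitaryGroup (Fin 2) ℂ |
                  ∀ U : GaugeField (F.P K) 0 (Matrix.specialUnitaryGroup (Fin 2) ℂ),
                    descendTo F ℰp J K hJK.le (GaugeField.gaugeAct w U) = descendTo F ℰp J K hJK.le U},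
                ∑ ℓ : PBond (F.P K) 0,
                  dist1 (U ℓ * ((GaugeField.gaugeAct (w : Site (F.P K) 0 → Matrix.specialUnitaryGroup (Fin 2) ℂ) U₀) ℓ)⁻¹) ^ 2) = 0) →
        ∃ μ : ℝ, 0 < μ ∧ ∀ U ∈ fibre F ℰp J K hJK.le V, U ∈ histGood F ℰp (θBal F.L γ b₀ p₀) K J →
          (∃ w : Site (F.P K) 0 → Matrix.specialUnitaryGroup (Fin 2) ℂ,
              (∀ U'' : GaugeField (F.P K) 0 (Matrix.specialUnitaryGroup (Fin 2) ℂ),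
                  descendTo F ℰp J K hJK.le (GaugeField.gaugeAct w U'') = descendTo F ℰp J K hJK.le U'') ∧
                ∀ ℓ : PBond (F.P K) 0, dist1 (U ℓ * ((GaugeField.gaugeAct w U₀) ℓ)⁻¹) ≤ δ) →
          μ * ((F.L : ℝ)⁻¹) ^ (2 * (K - J)) *
              (⨅ w : {w : Site (F.P K) 0 → Matrix.specialUnitaryGroup (Fin 2) ℂ |
                  ∀ U : GaugeField (F.P K) 0 (Matrix.specialUnitaryGroup (Fin 2) ℂ),
                    descendTo F ℰp J K hJK.le (GaugeField.gaugeAct w U) = descendTo F ℰp J K hJK.le U},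
                ∑ ℓ : PBond (F.P K) 0,
                  dist1 (U ℓ * ((GaugeField.gaugeAct (w : Site (F.P K) 0 → Matrix.specialUnitaryGroup (Fin 2) ℂ) U₀) ℓ)⁻¹) ^ 2)
            ≤ wilsonAction4 U - minActionRegPr F J K hJK.le ε₀ V := by
  obtain ⟨e₉, he₉, H⟩ := growthOn_nhds_at_isCritR2_of_irr_five' L h5
  refine ⟨e₉, he₉, ?_⟩
  intro F hF J K hJK γ b₀ p₀ ε₀ V U₀ δ hε₀ hεe hU₀reg hcrit hmin hirr hisol
  obtain ⟨N, hN, c, hc, hgrowN⟩ := H F hF J K hJK γ b₀ p₀ ε₀ V U₀ hε₀ hεe hU₀reg hcrit hmin hirr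
  exact FluctuationComparisonRegPrIntLS2BetaPosCollarOfLocalGrowth.tubeGrowth_of_growthOn_nhds_of_isolated F hJK.le V U₀ δ hN hc hgrowN hisol

end Irr

/-! ## §2 The same, keyed on pen 4's GROUP token (central stabiliser) through (T7d) -/

section CentralStab

/-- ★★★ **POS∘ AT PRINT'S REGULAR MINIMISER OVER A CENTRAL-STABILISER DATUM ⟸ pen 4's token ALONE** (`ε₀ ≤ e₉(L)`) — §1 ∘ ✓(T7d) `irr_of_centralStab`.
[cite: Balaban1985Variational, (4) p.278, Thm 1 (8)-(10) p.279, Prop. 7 and (141)-(143) p.299; Balaban1985UV3, (12)-(13) p.259] -/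
theorem posCollar_at_isCritR2_of_centralStab_five (L : ℕ) (h5 : 5 ≤ L) :
    ∃ e₉ : ℝ, 0 < e₉ ∧
      ∀ (F : T3Family), F.L = L → ∀ (J K : ℕ) (hJK : J < K) (γ b₀ p₀ ε₀ : ℝ)
        (V : GaugeField (F.P J) 0 (Matrix.specialUnitaryGroup (Fin 2) ℂ)) (U₀ : GaugeField (F.P K) 0 (Matrix.specialUnitaryGroup (Fin 2) ℂ)) (δ : ℝ),
        0 < ε₀ → ε₀ ≤ e₉ → U₀ ∈ regFibrePr F J K hJK.le ε₀ V → IsCritR2 F J K hJK.le V U₀ →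
        wilsonAction4 U₀ = minActionRegPr F J K hJK.le ε₀ V →
        (∀ s : GaugeTransf (F.P J) 0 (Matrix.specialUnitaryGroup (Fin 2) ℂ), GaugeField.gaugeAct s V = V →
          s = (fun _ => 1) ∨ s = (fun _ => (⟨-1, neg_one_mem⟩ : Matrix.specialUnitaryGroup (Fin 2) ℂ))) →
        ∃ r c : ℝ, 0 < r ∧ 0 < c ∧
          ∀ U ∈ closure (fibre F ℰp J K hJK.le V ∩ histGood F ℰp (θBal F.L γ b₀ p₀) K J),
            (∃ w : Site (F.P K) 0 → Matrix.specialUnitaryGroup (Fin 2) ℂ,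
              (∀ U'' : GaugeField (F.P K) 0 (Matrix.specialUnitaryGroup (Fin 2) ℂ),
                  descendTo F ℰp J K hJK.le (GaugeField.gaugeAct w U'') = descendTo F ℰp J K hJK.le U'') ∧
                ∀ ℓ : PBond (F.P K) 0, dist1 (U ℓ * ((GaugeField.gaugeAct w U₀) ℓ)⁻¹) ≤ δ) →
            (⨅ w : {w : Site (F.P K) 0 → Matrix.specialUnitaryGroup (Fin 2) ℂ |
                  ∀ U : GaugeField (F.P K) 0 (Matrix.specialUnitaryGroup (Fin 2) ℂ),
                    descendTo F ℰp J K hJK.le (GaugeField.gaugeAct w U) = descendTo F ℰp J K hJK.le U},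
                ∑ ℓ : PBond (F.P K) 0,
                  dist1 (U ℓ * ((GaugeField.gaugeAct (w : Site (F.P K) 0 → Matrix.specialUnitaryGroup (Fin 2) ℂ) U₀) ℓ)⁻¹) ^ 2) ≤ r →
            c * (⨅ w : {w : Site (F.P K) 0 → Matrix.specialUnitaryGroup (Fin 2) ℂ |
                  ∀ U : GaugeField (F.P K) 0 (Matrix.specialUnitaryGroup (Fin 2) ℂ),
                    descendTo F ℰp J K hJK.le (GaugeField.gaugeAct w U) = descendTo F ℰp J K hJK.le U},
                ∑ ℓ : PBond (F.P K) 0,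
                  dist1 (U ℓ * ((GaugeField.gaugeAct (w : Site (F.P K) 0 → Matrix.specialUnitaryGroup (Fin 2) ℂ) U₀) ℓ)⁻¹) ^ 2)
              ≤ wilsonAction4 U - minActionRegPr F J K hJK.le ε₀ V := by
  obtain ⟨e₉, he₉, H⟩ := posCollar_at_isCritR2_of_irr_five' L h5
  refine ⟨e₉, he₉, ?_⟩
  intro F hF J K hJK γ b₀ p₀ ε₀ V U₀ δ hε₀ hεe hU₀reg hcrit hmin hstab
  exact H F hF J K hJK γ b₀ p₀ ε₀ V U₀ δ hε₀ hεe hU₀reg hcrit hmin (irr_of_centralStab F V hstab)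

/-- ★★★ **TUBE♭(V,U₀) AT PRINT'S REGULAR MINIMISER OVER A CENTRAL-STABILISER DATUM ⟸ {pen 4's token, ISOL∘(δ)}** — §1 ∘ ✓(T7d) `irr_of_centralStab`.
[cite: Balaban1985Variational, (4) p.278, Thm 1 (8)-(10) p.279, Prop. 7 and (141)-(143) p.299; Balaban1985UV3, (12)-(13) p.259 and (18)-(22) p.260] -/
theorem tubeGrowth_at_isCritR2_of_centralStab_of_isolated_five (L : ℕ) (h5 : 5 ≤ L) :
    ∃ e₉ : ℝ, 0 < e₉ ∧
      ∀ (F : T3Family), F.L = L → ∀ (J K : ℕ) (hJK : J < K) (γ b₀ p₀ ε₀ : ℝ)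
        (V : GaugeField (F.P J) 0 (Matrix.specialUnitaryGroup (Fin 2) ℂ)) (U₀ : GaugeField (F.P K) 0 (Matrix.specialUnitaryGroup (Fin 2) ℂ)) (δ : ℝ),
        0 < ε₀ → ε₀ ≤ e₉ → U₀ ∈ regFibrePr F J K hJK.le ε₀ V → IsCritR2 F J K hJK.le V U₀ →
        wilsonAction4 U₀ = minActionRegPr F J K hJK.le ε₀ V →
        (∀ s : GaugeTransf (F.P J) 0 (Matrix.specialUnitaryGroup (Fin 2) ℂ), GaugeField.gaugeAct s V = V →
          s = (fun _ => 1) ∨ s = (fun _ => (⟨-1, neg_one_mem⟩ : Matrix.specialUnitaryGroup (Fin 2) ℂ))) →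
        (∀ U ∈ closure (fibre F ℰp J K hJK.le V ∩ histGood F ℰp (θBal F.L γ b₀ p₀) K J),
            (∃ w : Site (F.P K) 0 → Matrix.specialUnitaryGroup (Fin 2) ℂ,
              (∀ U'' : GaugeField (F.P K) 0 (Matrix.specialUnitaryGroup (Fin 2) ℂ),
                  descendTo F ℰp J K hJK.le (GaugeField.gaugeAct w U'') = descendTo F ℰp J K hJK.le U'') ∧
                ∀ ℓ : PBond (F.P K) 0, dist1 (U ℓ * ((GaugeField.gaugeAct w U₀) ℓ)⁻¹) ≤ δ) →
            wilsonAction4 U ≤ minActionRegPr F J K hJK.le ε₀ V →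
            (⨅ w : {w : Site (F.P K) 0 → Matrix.specialUnitaryGroup (Fin 2) ℂ |
                  ∀ U : GaugeField (F.P K) 0 (Matrix.specialUnitaryGroup (Fin 2) ℂ),
                    descendTo F ℰp J K hJK.le (GaugeField.gaugeAct w U) = descendTo F ℰp J K hJK.le U},
                ∑ ℓ : PBond (F.P K) 0,
                  dist1 (U ℓ * ((GaugeField.gaugeAct (w : Site (F.P K) 0 → Matrix.specialUnitaryGroup (Fin 2) ℂ) U₀) ℓ)⁻¹) ^ 2) = 0) →
        ∃ μ : ℝ, 0 < μ ∧ ∀ U ∈ fibre F ℰp J K hJK.le V, U ∈ histGood F ℰp (θBal F.L γ b₀ p₀) K J →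
          (∃ w : Site (F.P K) 0 → Matrix.specialUnitaryGroup (Fin 2) ℂ,
              (∀ U'' : GaugeField (F.P K) 0 (Matrix.specialUnitaryGroup (Fin 2) ℂ),
                  descendTo F ℰp J K hJK.le (GaugeField.gaugeAct w U'') = descendTo F ℰp J K hJK.le U'') ∧
                ∀ ℓ : PBond (F.P K) 0, dist1 (U ℓ * ((GaugeField.gaugeAct w U₀) ℓ)⁻¹) ≤ δ) →
          μ * ((F.L : ℝ)⁻¹) ^ (2 * (K - J)) *
              (⨅ w : {w : Site (F.P K) 0 → Matrix.specialUnitaryGroup (Fin 2) ℂ |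
                  ∀ U : GaugeField (F.P K) 0 (Matrix.specialUnitaryGroup (Fin 2) ℂ),
                    descendTo F ℰp J K hJK.le (GaugeField.gaugeAct w U) = descendTo F ℰp J K hJK.le U},
                ∑ ℓ : PBond (F.P K) 0,
                  dist1 (U ℓ * ((GaugeField.gaugeAct (w : Site (F.P K) 0 → Matrix.specialUnitaryGroup (Fin 2) ℂ) U₀) ℓ)⁻¹) ^ 2)
            ≤ wilsonAction4 U - minActionRegPr F J K hJK.le ε₀ V := by
  obtain ⟨e₉, he₉, H⟩ := tubeGrowth_at_isCritR2_of_irr_of_isolated_five' L h5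
  refine ⟨e₉, he₉, ?_⟩
  intro F hF J K hJK γ b₀ p₀ ε₀ V U₀ δ hε₀ hεe hU₀reg hcrit hmin hstab hisol
  exact H F hF J K hJK γ b₀ p₀ ε₀ V U₀ δ hε₀ hεe hU₀reg hcrit hmin (irr_of_centralStab F V hstab) hisol

end CentralStab

/-! ## §3 ISOL∘(δ) discharged too: TUBE♭ at a central-stabiliser datum from pen 4's token and the tube-regularity row `hreg` alone -/

section Isol

/-- ★★★★ **TUBE♭(V,U₀) AT PRINT'S REGULAR MINIMISER OVER A CENTRAL-STABILISER DATUM ⟸ {pen 4's token, `hreg`(δ)} — ISOL∘(δ), (Lπ)_loc, `hcont`, HESS∘, (E), (Ls) ALL DISCHARGED.**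
For every `L ≥ 5` there is `e₉ > 0` (`min` of §1's threshold and pen 4's `e₈`) such that at every member `(F, J < K)`, every `0 < ε₀ ≤ e₉`, every datum `V` whose `SU(2)`-valued
symmetries are `±1` (✓pen 4's token VERBATIM), every R2-critical `U₀ ∈ regFibrePr ε₀ V` realising `minActionRegPr ε₀ V`, and every tube radius `δ` for which the tube minimisers of
the closed good fibre are `ε₀`-regular (`hreg` — ✓px8 `isol_of_atMostOneCriticalOrbit`'s binder VERBATIM; ✓∕⧗px16 g18 `exists_delta_hreg` for `δ ≤ δ₀(U₀)`), TUBE♭(V,U₀) holds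
(text VERBATIM).  Composition: §2 ∘ ✓px8 p798217 `isol_of_atMostOneCriticalOrbit` ∘ ✓pen 4 p798004 `atMostOneCriticalOrbit_of_centralStab_five`.
[cite: Balaban1985Variational, (4)-(6) p.278, Thm 1 (8)-(10) p.279, Prop. 7 and (141)-(143) p.299; Balaban1985UV3, (12)-(13) p.259 and (18)-(22) p.260] -/
theorem tubeGrowth_at_isCritR2_of_centralStab_of_hreg_five (L : ℕ) (h5 : 5 ≤ L) :
    ∃ e₉ : ℝ, 0 < e₉ ∧
      ∀ (F : T3Family), F.L = L → ∀ (J K : ℕ) (hJK : J < K) (γ b₀ p₀ ε₀ : ℝ)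
        (V : GaugeField (F.P J) 0 (Matrix.specialUnitaryGroup (Fin 2) ℂ)) (U₀ : GaugeField (F.P K) 0 (Matrix.specialUnitaryGroup (Fin 2) ℂ)) (δ : ℝ),
        0 < ε₀ → ε₀ ≤ e₉ → U₀ ∈ regFibrePr F J K hJK.le ε₀ V → IsCritR2 F J K hJK.le V U₀ →
        wilsonAction4 U₀ = minActionRegPr F J K hJK.le ε₀ V →
        (∀ s : GaugeTransf (F.P J) 0 (Matrix.specialUnitaryGroup (Fin 2) ℂ), GaugeField.gaugeAct s V = V →
          s = (fun _ => 1) ∨ s = (fun _ => (⟨-1, neg_one_mem⟩ : Matrix.specialUnitaryGroup (Fin 2) ℂ))) →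
        (∀ U ∈ closure (fibre F ℰp J K hJK.le V ∩ histGood F ℰp (θBal F.L γ b₀ p₀) K J),
            (∃ w : Site (F.P K) 0 → Matrix.specialUnitaryGroup (Fin 2) ℂ,
              (∀ U'' : GaugeField (F.P K) 0 (Matrix.specialUnitaryGroup (Fin 2) ℂ),
                  descendTo F ℰp J K hJK.le (GaugeField.gaugeAct w U'') = descendTo F ℰp J K hJK.le U'') ∧
                ∀ ℓ : PBond (F.P K) 0, dist1 (U ℓ * ((GaugeField.gaugeAct w U₀) ℓ)⁻¹) ≤ δ) →
            wilsonAction4 U ≤ minActionRegPr F J K hJK.le ε₀ V → U ∈ regFibrePr F J K hJK.le ε₀ V) →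
        ∃ μ : ℝ, 0 < μ ∧ ∀ U ∈ fibre F ℰp J K hJK.le V, U ∈ histGood F ℰp (θBal F.L γ b₀ p₀) K J →
          (∃ w : Site (F.P K) 0 → Matrix.specialUnitaryGroup (Fin 2) ℂ,
              (∀ U'' : GaugeField (F.P K) 0 (Matrix.specialUnitaryGroup (Fin 2) ℂ),
                  descendTo F ℰp J K hJK.le (GaugeField.gaugeAct w U'') = descendTo F ℰp J K hJK.le U'') ∧
                ∀ ℓ : PBond (F.P K) 0, dist1 (U ℓ * ((GaugeField.gaugeAct w U₀) ℓ)⁻¹) ≤ δ) →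
          μ * ((F.L : ℝ)⁻¹) ^ (2 * (K - J)) *
              (⨅ w : {w : Site (F.P K) 0 → Matrix.specialUnitaryGroup (Fin 2) ℂ |
                  ∀ U : GaugeField (F.P K) 0 (Matrix.specialUnitaryGroup (Fin 2) ℂ),
                    descendTo F ℰp J K hJK.le (GaugeField.gaugeAct w U) = descendTo F ℰp J K hJK.le U},
                ∑ ℓ : PBond (F.P K) 0,
                  dist1 (U ℓ * ((GaugeField.gaugeAct (w : Site (F.P K) 0 → Matrix.specialUnitaryGroup (Fin 2) ℂ) U₀) ℓ)⁻¹) ^ 2)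
            ≤ wilsonAction4 U - minActionRegPr F J K hJK.le ε₀ V := by
  obtain ⟨e₈, he₈, H⟩ := tubeGrowth_at_isCritR2_of_centralStab_of_isolated_five L h5
  obtain ⟨e₈', he₈', H1⟩ := atMostOneCriticalOrbit_of_centralStab_five L h5
  refine ⟨min e₈ e₈', lt_min he₈ he₈', ?_⟩
  intro F hF J K hJK γ b₀ p₀ ε₀ V U₀ δ hε₀ hεe hU₀reg hcrit hmin hstab hreg
  have h1 := H1 F hF J K hJK ε₀ V hε₀ (hεe.trans (min_le_right _ _)) hstab
  exact H F hF J K hJK γ b₀ p₀ ε₀ V U₀ δ hε₀ (hεe.trans (min_le_left _ _)) hU₀reg hcrit hmin hstab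
    (isol_of_atMostOneCriticalOrbit F hJK.le hε₀ V U₀ δ h1 hU₀reg hmin hreg)

end Isol

/-! ## §4 `hreg` discharged for small tubes: TUBE♭ for every `δ ≤ δ₀(U₀)` from pen 4's token and the closed-good-fibre row CL(V) alone -/

section SmallTube

/-- ★★★★ **TUBE♭(V,U₀) FOR EVERY SMALL TUBE RADIUS AT PRINT'S REGULAR MINIMISER OVER A CENTRAL-STABILISER DATUM ⟸ {pen 4's token, CL(V)} — `hreg` DISCHARGED TOO
(✓px16 g18 `…S2BetaTubeRegularSmall.exists_delta_isol_of_atMostOneCriticalOrbit`: the regular class absorbs a small sup-tube about every gauge translate of `U₀`).**  For every `L ≥ 5`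
there is `e₉ > 0` such that at every member `(F, J < K)`, every `0 < ε₀ ≤ e₉`, every datum `V` whose `SU(2)`-valued symmetries are `±1`, every R2-critical `U₀ ∈ regFibrePr ε₀ V`
realising `minActionRegPr ε₀ V`, under CL(V) (`closure (fibre V ∩ histGood) ⊆ fibre V` — ✓`exists_gamma_closedGoodFibre`, `γ ≤ γ₁`): `∃ δ₀ > 0, ∀ δ ≤ δ₀`, TUBE♭(V,U₀;δ) (text VERBATIM).
PER-DATUM LETTERS LEFT: NONE beyond the token and CL(V); `δ₀` is per base point (openness of the regular class), NOT the organ's datum-free `δ` (TUBE-REG∘ stays open).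
[cite: Balaban1985Variational, (4)-(6) p.278, Thm 1 (8)-(10) p.279, Prop. 7 and (141)-(143) p.299; Balaban1985UV3, (12)-(13) p.259 and (18)-(22) p.260] -/
theorem tubeGrowth_smallTube_at_isCritR2_of_centralStab_of_CL_five (L : ℕ) (h5 : 5 ≤ L) :
    ∃ e₉ : ℝ, 0 < e₉ ∧
      ∀ (F : T3Family), F.L = L → ∀ (J K : ℕ) (hJK : J < K) (γ b₀ p₀ ε₀ : ℝ)
        (V : GaugeField (F.P J) 0 (Matrix.specialUnitaryGroup (Fin 2) ℂ)) (U₀ : GaugeField (F.P K) 0 (Matrix.specialUnitaryGroup (Fin 2) ℂ)),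
        0 < ε₀ → ε₀ ≤ e₉ → U₀ ∈ regFibrePr F J K hJK.le ε₀ V → IsCritR2 F J K hJK.le V U₀ →
        wilsonAction4 U₀ = minActionRegPr F J K hJK.le ε₀ V →
        (∀ s : GaugeTransf (F.P J) 0 (Matrix.specialUnitaryGroup (Fin 2) ℂ), GaugeField.gaugeAct s V = V →
          s = (fun _ => 1) ∨ s = (fun _ => (⟨-1, neg_one_mem⟩ : Matrix.specialUnitaryGroup (Fin 2) ℂ))) →
        closure (fibre F ℰp J K hJK.le V ∩ histGood F ℰp (θBal F.L γ b₀ p₀) K J) ⊆ fibre F ℰp J K hJK.le V →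
        ∃ δ₀ : ℝ, 0 < δ₀ ∧ ∀ δ : ℝ, δ ≤ δ₀ →
        ∃ μ : ℝ, 0 < μ ∧ ∀ U ∈ fibre F ℰp J K hJK.le V, U ∈ histGood F ℰp (θBal F.L γ b₀ p₀) K J →
          (∃ w : Site (F.P K) 0 → Matrix.specialUnitaryGroup (Fin 2) ℂ,
              (∀ U'' : GaugeField (F.P K) 0 (Matrix.specialUnitaryGroup (Fin 2) ℂ),
                  descendTo F ℰp J K hJK.le (GaugeField.gaugeAct w U'') = descendTo F ℰp J K hJK.le U'') ∧
                ∀ ℓ : PBond (F.P K) 0, dist1 (U ℓ * ((GaugeField.gaugeAct w U₀) ℓ)⁻¹) ≤ δ) →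
          μ * ((F.L : ℝ)⁻¹) ^ (2 * (K - J)) *
              (⨅ w : {w : Site (F.P K) 0 → Matrix.specialUnitaryGroup (Fin 2) ℂ |
                  ∀ U : GaugeField (F.P K) 0 (Matrix.specialUnitaryGroup (Fin 2) ℂ),
                    descendTo F ℰp J K hJK.le (GaugeField.gaugeAct w U) = descendTo F ℰp J K hJK.le U},
                ∑ ℓ : PBond (F.P K) 0,
                  dist1 (U ℓ * ((GaugeField.gaugeAct (w : Site (F.P K) 0 → Matrix.specialUnitaryGroup (Fin 2) ℂ) U₀) ℓ)⁻¹) ^ 2)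
            ≤ wilsonAction4 U - minActionRegPr F J K hJK.le ε₀ V := by
  obtain ⟨e₈, he₈, H⟩ := tubeGrowth_at_isCritR2_of_centralStab_of_isolated_five L h5
  obtain ⟨e₈', he₈', H1⟩ := atMostOneCriticalOrbit_of_centralStab_five L h5
  refine ⟨min e₈ e₈', lt_min he₈ he₈', ?_⟩
  intro F hF J K hJK γ b₀ p₀ ε₀ V U₀ hε₀ hεe hU₀reg hcrit hmin hstab hCL
  have h1 := H1 F hF J K hJK ε₀ V hε₀ (hεe.trans (min_le_right _ _)) hstab
  obtain ⟨δ₀, hδ₀, hisol⟩ :=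
    FluctuationComparisonRegPrIntLS2BetaTubeRegularSmall.exists_delta_isol_of_atMostOneCriticalOrbit F hJK.le hε₀ V U₀ h1 hU₀reg hmin hCL
  refine ⟨δ₀, hδ₀, fun δ hδ => ?_⟩
  exact H F hF J K hJK γ b₀ p₀ ε₀ V U₀ δ hε₀ (hεe.trans (min_le_left _ _)) hU₀reg hcrit hmin hstab (hisol δ hδ)

end SmallTube

end Summit.QuantumFields.YangMills.Theorems.FluctuationComparisonRegPrIntLS2BetaTubeGrowthAtIrreducible

end
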